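import Summits.ResolutionOfSingularities.ResolutionOfSingularities.Theorems.HilbertSamuelEliminationSigmaMaxModificationsCorridor3CPFramePropagationChart
import Summits.ResolutionOfSingularities.ResolutionOfSingularities.Theorems.HilbertSamuelEliminationSigmaMaxModificationsCorridor3CPFrameCompletion
import Summits.ResolutionOfSingularities.ResolutionOfSingularities.Theorems.HilbertSamuelEliminationSigmaMaxModificationsCorridor3WLadderCPFrameTranslate
import Literature.AlgebraicGeometry.Resolution.CharPolyhedronVertexPreparationHolds
import Literature.RingTheory.HilbertSamuel.TangentConeIdeal
import HarnessLib

/-!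
# [OURS · L1 W4.2] D18 G5 (ii-d): COMPLETING the base and PREPARING the vertex — from a frame presentation over a regular local ring with
# `δ ≥ 1` to a MINIMAL CP frame over its completion, `δ ≥ 1` kept (res-lit-4's `exists_mem_span_isMinimal_comp_X_add_C_of_span_eq_maximalIdeal`)
# (cell res-hironaka, LADDER-RESOLUTION rung L; slot W4.2, crux chain w42 `SigmaMaxModificationsCorridor3` stmt-ResolutionOfSingularities-19249;
# `--supports stmt-ResolutionOfSingularities-19249 --as helper`; hand res-D-brk-3 (gen 6), cut G5 of TAKING 13:03:41Z)

PURE COMMUTATIVE ALGEBRA (universe `0`), 0 `def`s, every declaration PROVED; OURS bookkeeping; NOT a statement of Hironaka's manuscript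
[Hironaka2017] nor of [CossartJannsenSaito2020]/[CossartPiltant2019]. AI-written, weaker than expert review.

* `maximalIdeal_quotient_eq_frameIdeal` — for a frame ring `R[X]/(h)` with lower coefficients in `𝔪_R` and `(u) = 𝔪_R`: its maximal ideal is
  `((u)·R[X] + (X))/(h)` — the POINT-centre ideal `J` of `exists_adjoinRoot_chart_presentation` (G5 ii-b).
* **`exists_complete_minimal_frame`** — INPUT: `R₁` regular local of dimension `3`, `h₁ ∈ R₁[X]` monic of degree `m ≥ 1` with
  `coeff_i h₁ ∈ 𝔪^{m−i}`, `R₁[X]/(h₁)` local, a presentation `φ₁ : O₀ → R₁[X]/(h₁)` (flat, local, `𝔪 ↦ 𝔪`, residue-onto) — the output of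
  G5 (ii-c). OUTPUT: a MINIMAL CP frame at `O₀`: `R' = R̂₁` complete regular local of dimension `3` with an r.s.p. `u'`, `h₂ ∈ R'[X]` monic of
  degree `m` with `coeff_i h₂ ∈ 𝔪^{m−i}` (the prepared translate `h₁^{R'}(X + θ)`, `θ ∈ 𝔪`), `R'[X]/(h₂)` local, a presentation
  `φ₂ : O₀ → R'[X]/(h₂)`, and `CossartPiltant.IsMinimal u' h₂` — all the clauses of res-type-067's `IsCPFrame` plus `δ ≥ 1`. Ingredients:
  p530670 (`adicCompletion_frame_data`, `adicCompletion_presentation`), res-lit-4's vertex preparation over complete regular local rings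
  [Hironaka1967]/[CossartPiltant2019, Prop. 2.2–2.3], 050's translation `algEquivAevalXAddC`.

References: CP 2019 Prop. 2.2–2.3, Def. 2.4 [CossartPiltant2019]; Hironaka 1967 (3.10) [Hironaka1967]; Matsumura Thm. 8.14 [Matsumura1987].
-/

noncomputable section

set_option linter.dupNamespace false

open IsLocalRing Polynomial
open Literature.AlgebraicGeometry.Resolution Literature.RingTheory.HilbertSamuel
open Summit.ResolutionOfSingularities.ResolutionOfSingularities.Theorems.SigmaMaxModificationsCorridor3.Moving

namespace Summit.ResolutionOfSingularities.ResolutionOfSingularities.Theorems.SigmaMaxModificationsCorridor3.Helpers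

/-- For a frame ring `R[X]/(h)` (`h` monic of degree `m ≥ 1`, lower coefficients in `𝔪_R = (u)`), the maximal ideal is `((u)R[X] + (X))/(h)`.
[folklore] -/
theorem maximalIdeal_quotient_eq_frameIdeal {R : Type} [CommRing R] [IsLocalRing R] {n : ℕ} {u : Fin n → R}
    (hu : Ideal.span (Set.range u) = maximalIdeal R) {h : R[X]} (hmo : h.Monic) (hm : 0 < h.natDegree)
    (hco : ∀ i < h.natDegree, h.coeff i ∈ maximalIdeal R) [IsLocalRing (R[X] ⧸ Ideal.span {h})] :
    maximalIdeal (R[X] ⧸ Ideal.span {h}) =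
      ((Ideal.span (Set.range u)).map (C : R →+* R[X]) ⊔ Ideal.span {X}).map (Ideal.Quotient.mk (Ideal.span {h})) := by
  haveI : IsLocalRing (AdjoinRoot h) := ‹IsLocalRing (R[X] ⧸ Ideal.span {h})›
  obtain ⟨_, hmax⟩ := exists_isLocalRing_adjoinRoot_of_coeff_mem hmo hm hco
  have h1 : maximalIdeal (AdjoinRoot h) = (maximalIdeal R).map (AdjoinRoot.of h) ⊔ Ideal.span {AdjoinRoot.root h} := hmax
  rw [Ideal.map_sup, Ideal.map_map, Ideal.map_span _ {X}, Set.image_singleton, hu]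
  exact h1

/-- [OURS · L1 W4.2] **Completion and vertex preparation: a minimal CP frame from a frame presentation with `δ ≥ 1`.** See the module
docstring. [cite: CossartPiltant2019, Prop. 2.2–2.3, Def. 2.4 (arXiv v1 pp. 11–12)] [cite: Matsumura1987, Thm. 8.14] -/
theorem exists_complete_minimal_frame {R₁ : Type} [CommRing R₁] [IsRegularLocalRing R₁] (hdim : ringKrullDim R₁ = (3 : ℕ))
    {h₁ : R₁[X]} (hmo : h₁.Monic) (hm : 0 < h₁.natDegree) (hco : ∀ i < h₁.natDegree, h₁.coeff i ∈ maximalIdeal R₁ ^ (h₁.natDegree - i))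
    [IsLocalRing (R₁[X] ⧸ Ideal.span {h₁})] {O₀ : Type} [CommRing O₀] [IsLocalRing O₀] (φ₁ : O₀ →+* R₁[X] ⧸ Ideal.span {h₁})
    (hloc : IsLocalHom φ₁) (hflat : φ₁.Flat) (hmap : (maximalIdeal O₀).map φ₁ = maximalIdeal _)
    (hres : Function.Surjective ((residue _).comp φ₁)) :
    ∃ (R' : Type) (_ : CommRing R') (_ : IsRegularLocalRing R') (u' : Fin 3 → R') (h₂ : R'[X])
      (_ : IsLocalRing (R'[X] ⧸ Ideal.span {h₂})) (φ₂ : O₀ →+* R'[X] ⧸ Ideal.span {h₂}),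
      IsAdicComplete (maximalIdeal R') R' ∧ ringKrullDim R' = 3 ∧ Ideal.span (Set.range u') = maximalIdeal R' ∧ h₂.Monic ∧
      h₂.natDegree = h₁.natDegree ∧ (∀ i < h₂.natDegree, h₂.coeff i ∈ maximalIdeal R' ^ (h₂.natDegree - i)) ∧
      IsLocalHom φ₂ ∧ φ₂.Flat ∧ (maximalIdeal O₀).map φ₂ = maximalIdeal _ ∧ Function.Surjective ((residue _).comp φ₂) ∧
      CossartPiltant.IsMinimal u' h₂ := by
  -- an r.s.p. of `R₁`
  have hd : (maximalIdeal R₁).spanFinrank = 3 := CossartPiltant.spanFinrank_maximalIdeal_eq_of_ringKrullDim_eq hdim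
  obtain ⟨u₁, hu₁⟩ := exists_span_range_eq_maximalIdeal R₁ hd.le
  -- completing the base
  obtain ⟨hreg, hcpl, hdim', hu', hmon', hdeg', hcoef'⟩ := adicCompletion_frame_data hu₁ hmo
  obtain ⟨hloc', hψloc, hψflat, hψmap, hψres⟩ :=
    adicCompletion_presentation hmo hm (fun i hi => Ideal.pow_le_self (by omega) (hco i hi)) hloc hflat hmap hres
  haveI := hreg
  haveI := hloc'
  set R' := AdicCompletion (maximalIdeal R₁) R₁ with hR'
  set hh := h₁.map (algebraMap R₁ R') with hhh
  have hdim3 : ringKrullDim R' = (3 : ℕ) := hdim'.trans hdim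
  -- vertex preparation with `θ ∈ 𝔪`, keeping `δ ≥ 1`
  have hcoefIcc : ∀ i ∈ Finset.Icc 1 hh.natDegree,
      hh.coeff (hh.natDegree - i) ∈ Ideal.span ((algebraMap R₁ R' ∘ u₁) '' ↑(Finset.univ : Finset (Fin 3))) ^ i := by
    intro i hi
    rw [Finset.coe_univ, Set.image_univ, hu', hdeg']
    have hi' := Finset.mem_Icc.mp hi
    have h1 := hcoef' (h₁.natDegree - i) (h₁.natDegree - (h₁.natDegree - i)) (hco _ (by omega))
    rwa [show h₁.natDegree - (h₁.natDegree - i) = i by omega] at h1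
  obtain ⟨θ, hθ, hmin, hcoef₂⟩ := CossartPiltant.exists_mem_span_isMinimal_comp_X_add_C_of_span_eq_maximalIdeal
    (algebraMap R₁ R' ∘ u₁) hu' hdim3 hmon' Finset.univ hcoefIcc
  -- the translate and its presentation
  have hmon₂ : (hh.comp (X + C θ)).Monic := hmon'.comp (monic_X_add_C θ) (by rw [natDegree_X_add_C]; exact one_ne_zero)
  have hdeg₂ : (hh.comp (X + C θ)).natDegree = h₁.natDegree := by
    rw [← hdeg', ← taylor_apply, natDegree_taylor]
  let e : (R'[X] ⧸ Ideal.span {hh}) ≃+* R'[X] ⧸ Ideal.span {hh.comp (X + C θ)} :=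
    Ideal.quotientEquiv (Ideal.span {hh}) (Ideal.span {hh.comp (X + C θ)})
      (algEquivAevalXAddC θ : R'[X] ≃ₐ[R'] R'[X]).toRingEquiv (by rw [span_translate_eq_map]; rfl)
  haveI hloc₂ : IsLocalRing (R'[X] ⧸ Ideal.span {hh.comp (X + C θ)}) := e.isLocalRing
  obtain ⟨hf₂, hl₂, hm₂, hr₂⟩ := presentation_comp_ringEquiv _ hψflat hψloc hψmap hψres e
  refine ⟨R', inferInstance, hreg, algebraMap R₁ R' ∘ u₁, hh.comp (X + C θ), hloc₂, _, hcpl, hdim3, hu', hmon₂, hdeg₂, ?_,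
    hl₂, hf₂, hm₂, hr₂, hmin⟩
  intro i hi
  rw [hdeg₂] at hi ⊢
  have h1 := hcoef₂ (h₁.natDegree - i) (Finset.mem_Icc.mpr ⟨by omega, by omega⟩)
  rw [hdeg', show h₁.natDegree - (h₁.natDegree - i) = i by omega, Finset.coe_univ, Set.image_univ, hu'] at h1
  exact h1

end Summit.ResolutionOfSingularities.ResolutionOfSingularities.Theorems.SigmaMaxModificationsCorridor3.Helpers

end
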